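import Summits.MatrixMultiplication.OmegaCensus.SmallFormats.InvertiblePointBlockFootprint
import HarnessLib

/-!
# ω-census family (a): the δ-TABLE of the δ-engine is a THEOREM — block-footprint spans for every Kronecker block type

Cell `pub-omega` (unit `pub-omega-tensor`, gen 34), topic `Summits/MatrixMultiplication/OmegaCensus` (sub-folder
`SmallFormats`). Framing (verbatim): lottery ticket; floor = certified bounds/negative ranges. HONEST FRAMING: elementary
linear algebra over an ARBITRARY field, continuing `InvertiblePointBlockFootprint` (p479963, tensor g24): that file proves
the δ-engine inequality `2n ≤ Σ_b δ_b + |Z|` at a saturated invertible point of a computation of `⟨2,2,n⟩` for every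
block family `(M_b, S_b)`, with `δ_b = dim (range(B ↦ (X ↦ X·B)) ⊓ 𝒯_b)`, `𝒯_b` the span of the maps `X ↦ f_s(X)·B` over the
off terms `s` and the `B` with `X·B − (f_s(X)/f_s(1))·B ∈ S_b` for all `X`. The census evaluated the numbers `δ_b` by
exact linear algebra over `𝔽₃`, check by check. Here they become THEOREMS, uniformly in the off forms (any linear
functionals `f` with `f(1) ≠ 0`) and over any field:

* `deltaSpan S` — the universal span (all `f` with `f 1 ≠ 0`); the census' `𝒯_b` is contained in it
  (`span_off_le_deltaSpan`).
* `vanish3_of_mem_deltaSpan` / `symm_of_mem_deltaSpan` — the MASTER LEMMA: if `X ↦ X·B` lies in `deltaSpan S` and `T`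
  is a column map with `S·T` inside the symmetric `2×2` matrices, then `N = B·T` has `N₀₀ = 0`, `N₀₁ + N₁₀ = 0`,
  `N₁₁ = 0` (three explicit linear functionals vanish on every generator — a two-line polynomial identity in the
  footprint conditions at `E₀₀, E₀₁, E₁₀` — and evaluate to these entries on `X ↦ X·B`).
* `pairCols v w`, `symm_on_span`, `dot_eq_zero_of_mem_deltaSpan` — the same with `T = (v | w)` a pair of columns and
  `S` a span, the symmetry being checked on generators only; `sum_ite_coe_eq` — bookkeeping for indicator sums.
The block-by-block consequences (the δ-TABLE `δ(L₁ᵀ) = 2`, `δ(L₂ᵀ) = 1`, `δ = 0` otherwise, and the exclusion of `L_ε`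
blocks) are in `InvertiblePointDeltaTable`. Nothing here is a rank bound by itself and nothing is a bound on `ω`.
-/

namespace Summit.MatrixMultiplication.OmegaCensus.SmallFormats

open Module Matrix Literature.Computability.AlgebraicComplexity

namespace DeltaBlocks

variable {k : Type*} [Field k] {m : ℕ}

/-- The generators of the universal block-footprint span of a block space `S ⊆ k^{2×m}`: the maps `X ↦ f(X)·B` for a
linear functional `f` on `M₂(k)` with `f(1) ≠ 0` and a `B` whose twisted footprint `X·B − (f(X)/f(1))·B` lies in `S` for
every `X`. -/
def deltaGen (S : Submodule k (Matrix (Fin 2) (Fin m) k)) :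
    Set (Matrix (Fin 2) (Fin 2) k →ₗ[k] Matrix (Fin 2) (Fin m) k) :=
  {L | ∃ f : Module.Dual k (Matrix (Fin 2) (Fin 2) k), f 1 ≠ 0 ∧ ∃ B : Matrix (Fin 2) (Fin m) k,
    (∀ X : Matrix (Fin 2) (Fin 2) k, X * B - (f X * (f 1)⁻¹) • B ∈ S) ∧ L = f.smulRight B}

/-- The universal block-footprint span `𝒯(S)` of a block space `S`. -/
def deltaSpan (S : Submodule k (Matrix (Fin 2) (Fin m) k)) :
    Submodule k (Matrix (Fin 2) (Fin 2) k →ₗ[k] Matrix (Fin 2) (Fin m) k) :=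
  Submodule.span k (deltaGen S)

/-- The census' span `𝒯_b` (generators indexed by the off terms `s ∈ O` of a computation, forms `f = β.f s` with
`f(1) ≠ 0`) is contained in the universal span. -/
theorem span_off_le_deltaSpan {ι : Type*} (F : ι → Module.Dual k (Matrix (Fin 2) (Fin 2) k)) (O : Finset ι)
    (hO' : ∀ i ∈ O, F i 1 ≠ 0) (S : Submodule k (Matrix (Fin 2) (Fin m) k)) :
    Submodule.span k {L : Matrix (Fin 2) (Fin 2) k →ₗ[k] Matrix (Fin 2) (Fin m) k |
        ∃ s ∈ O, ∃ B : Matrix (Fin 2) (Fin m) k,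
          (∀ X : Matrix (Fin 2) (Fin 2) k, X * B - (F s X * (F s 1)⁻¹) • B ∈ S) ∧ L = (F s).smulRight B}
      ≤ deltaSpan S := by
  apply Submodule.span_mono
  rintro L ⟨s, hs, B, hB, rfl⟩
  exact ⟨F s, hO' s hs, B, hB, rfl⟩

/-- Entries of `E_{ab} · N` for a `2 × m'` matrix `N`. -/
theorem single_one_mul_apply {m' : ℕ} (a b : Fin 2) (N : Matrix (Fin 2) (Fin m') k) (i : Fin 2)
    (j : Fin m') : (single a b (1 : k) * N) i j = if i = a then N b j else 0 := by
  split_ifs with h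
  · subst h; rw [single_mul_apply_same, one_mul]
  · rw [single_mul_apply_of_ne (h := h)]

/-- **Master lemma, generator case.** For a generator `X ↦ f(X)·B` of `deltaSpan S` and a column map `T` with `S·T`
symmetric, the three functionals vanish (a polynomial identity from the footprint conditions at `E₀₀, E₀₁, E₁₀`). -/
theorem vanish3_gen {S : Submodule k (Matrix (Fin 2) (Fin m) k)} {T : Matrix (Fin m) (Fin 2) k}
    (hT : ∀ W ∈ S, (W * T) 0 1 = (W * T) 1 0) {f : Module.Dual k (Matrix (Fin 2) (Fin 2) k)} (hf : f 1 ≠ 0)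
    {B : Matrix (Fin 2) (Fin m) k} (hB : ∀ X : Matrix (Fin 2) (Fin 2) k, X * B - (f X * (f 1)⁻¹) • B ∈ S) :
    (f.smulRight B (single 0 0 1) * T) 0 0 + (f.smulRight B (single 1 0 1) * T) 0 1 = 0 ∧
      (f.smulRight B (single 0 1 1) * T) 0 0 + (f.smulRight B (single 1 0 1) * T) 1 1 = 0 ∧
      (f.smulRight B (single 0 0 1) * T) 1 1 - (f.smulRight B (single 0 1 1) * T) 0 1 = 0 := by
  set N := B * T with hN
  -- the footprint conditions transported to `N = B T`
  have key : ∀ X : Matrix (Fin 2) (Fin 2) k,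
      (X * N - (f X * (f 1)⁻¹) • N) 0 1 = (X * N - (f X * (f 1)⁻¹) • N) 1 0 := by
    intro X
    have h := hT _ (hB X)
    have e : (X * B - (f X * (f 1)⁻¹) • B) * T = X * N - (f X * (f 1)⁻¹) • N := by
      rw [Matrix.sub_mul, Matrix.mul_assoc, Matrix.smul_mul]
    rw [e] at h
    exact h
  have k00 := key (single 0 0 1)
  have k01 := key (single 0 1 1)
  have k10 := key (single 1 0 1)
  simp only [Matrix.sub_apply, Matrix.smul_apply, smul_eq_mul, single_one_mul_apply] at k00 k01 k10
  simp only [Fin.isValue, ↓reduceIte, one_ne_zero, zero_ne_one] at k00 k01 k10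
  -- clear the denominators `f 1`
  have k00' : (f 1 - f (single 0 0 1)) * N 0 1 = -(f (single 0 0 1) * N 1 0) := by
    have := congrArg (· * f 1) k00
    field_simp at this
    linear_combination this
  have k01' : f 1 * N 1 1 - f (single 0 1 1) * N 0 1 = -(f (single 0 1 1) * N 1 0) := by
    have := congrArg (· * f 1) k01
    field_simp at this
    linear_combination this
  have k10' : -(f (single 1 0 1) * N 0 1) = f 1 * N 0 0 - f (single 1 0 1) * N 1 0 := by
    have := congrArg (· * f 1) k10
    field_simp at this
    linear_combination this
  refine ⟨?_, ?_, ?_⟩ <;>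
    simp only [LinearMap.smulRight_apply, Matrix.smul_mul, Matrix.smul_apply, smul_eq_mul, ← hN]
  · -- `f(E₀₀) N₀₀ + f(E₁₀) N₀₁ = 0`
    have : f 1 * (f (single 0 0 1) * N 0 0 + f (single 1 0 1) * N 0 1) = 0 := by
      linear_combination -(f (single 0 0 1)) * k10' + f (single 1 0 1) * k00'
    exact (mul_eq_zero.mp this).resolve_left hf
  · have : f 1 * (f (single 0 1 1) * N 0 0 + f (single 1 0 1) * N 1 1) = 0 := by
      linear_combination -(f (single 0 1 1)) * k10' + f (single 1 0 1) * k01'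
    exact (mul_eq_zero.mp this).resolve_left hf
  · have : f 1 * (f (single 0 0 1) * N 1 1 - f (single 0 1 1) * N 0 1) = 0 := by
      linear_combination f (single 0 0 1) * k01' - f (single 0 1 1) * k00'
    exact (mul_eq_zero.mp this).resolve_left hf

/-- **Master lemma.** If `L ∈ deltaSpan S` and `S·T` is symmetric then the three functionals
`(L(E₀₀)T)₀₀ + (L(E₁₀)T)₀₁`, `(L(E₀₁)T)₀₀ + (L(E₁₀)T)₁₁`, `(L(E₀₀)T)₁₁ − (L(E₀₁)T)₀₁` vanish on `L`. -/
theorem vanish3_of_mem_deltaSpan {S : Submodule k (Matrix (Fin 2) (Fin m) k)} {T : Matrix (Fin m) (Fin 2) k}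
    (hT : ∀ W ∈ S, (W * T) 0 1 = (W * T) 1 0) {L : Matrix (Fin 2) (Fin 2) k →ₗ[k] Matrix (Fin 2) (Fin m) k}
    (hL : L ∈ deltaSpan S) :
    (L (single 0 0 1) * T) 0 0 + (L (single 1 0 1) * T) 0 1 = 0 ∧
      (L (single 0 1 1) * T) 0 0 + (L (single 1 0 1) * T) 1 1 = 0 ∧
      (L (single 0 0 1) * T) 1 1 - (L (single 0 1 1) * T) 0 1 = 0 := by
  induction hL using Submodule.span_induction with
  | mem L hL =>
      obtain ⟨f, hf, B, hB, rfl⟩ := hL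
      exact vanish3_gen hT hf hB
  | zero => simp
  | add L L' _ _ h h' =>
      obtain ⟨h1, h2, h3⟩ := h
      obtain ⟨h1', h2', h3'⟩ := h'
      refine ⟨?_, ?_, ?_⟩ <;> simp only [LinearMap.add_apply, Matrix.add_mul, Matrix.add_apply]
      · linear_combination h1 + h1'
      · linear_combination h2 + h2'
      · linear_combination h3 + h3'
  | smul c L _ h =>
      obtain ⟨h1, h2, h3⟩ := h
      refine ⟨?_, ?_, ?_⟩ <;> simp only [LinearMap.smul_apply, Matrix.smul_mul, Matrix.smul_apply, smul_eq_mul]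
      · linear_combination c * h1
      · linear_combination c * h2
      · linear_combination c * h3

/-- **Master lemma for the right multiplications.** If `X ↦ X·B` lies in `deltaSpan S` and `S·T` is symmetric, then
`N = B·T` has `N₀₀ = 0`, `N₀₁ + N₁₀ = 0`, `N₁₁ = 0`. -/
theorem symm_of_mem_deltaSpan {S : Submodule k (Matrix (Fin 2) (Fin m) k)} {T : Matrix (Fin m) (Fin 2) k}
    (hT : ∀ W ∈ S, (W * T) 0 1 = (W * T) 1 0) {B : Matrix (Fin 2) (Fin m) k}
    (hB : (mulBilin k 2 2 m).flip B ∈ deltaSpan S) :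
    (B * T) 0 0 = 0 ∧ (B * T) 0 1 + (B * T) 1 0 = 0 ∧ (B * T) 1 1 = 0 := by
  obtain ⟨h1, h2, h3⟩ := vanish3_of_mem_deltaSpan hT hB
  simp only [LinearMap.flip_apply, mulBilin_apply, Matrix.mul_assoc, single_one_mul_apply] at h1 h2 h3
  simp only [Fin.isValue, ↓reduceIte, one_ne_zero, zero_ne_one, add_zero, zero_sub, neg_eq_zero] at h1 h2 h3
  exact ⟨h1, by rw [add_comm]; exact h2, h3⟩


/-! ## Column-pair maps and the standard block spaces -/

/-- The `m × 2` column map with columns `v` and `w`: `W ↦ (W·v | W·w)`. -/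
def pairCols (v w : Fin m → k) : Matrix (Fin m) (Fin 2) k := fun i j => if j = 0 then v i else w i

/-- First column of `W · pairCols v w` is `W·v`. -/
@[simp] theorem mul_pairCols_apply_zero (W : Matrix (Fin 2) (Fin m) k) (v w : Fin m → k) (a : Fin 2) :
    (W * pairCols v w) a 0 = W a ⬝ᵥ v := by
  simp [Matrix.mul_apply, pairCols, dotProduct]

/-- Second column of `W · pairCols v w` is `W·w`. -/
@[simp] theorem mul_pairCols_apply_one (W : Matrix (Fin 2) (Fin m) k) (v w : Fin m → k) (a : Fin 2) :
    (W * pairCols v w) a 1 = W a ⬝ᵥ w := by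
  simp [Matrix.mul_apply, pairCols, dotProduct]

/-- The symmetry condition `(W T)₀₁ = (W T)₁₀` for `T = pairCols v w` cuts out a submodule; so it holds on a span as
soon as it holds on the generators. -/
theorem symm_on_span {G : Set (Matrix (Fin 2) (Fin m) k)} {v w : Fin m → k}
    (hG : ∀ W ∈ G, W 0 ⬝ᵥ w = W 1 ⬝ᵥ v) :
    ∀ W ∈ Submodule.span k G, (W * pairCols v w) 0 1 = (W * pairCols v w) 1 0 := by
  intro W hW
  rw [mul_pairCols_apply_one, mul_pairCols_apply_zero]
  refine Submodule.span_induction (p := fun W _ => W 0 ⬝ᵥ w = W 1 ⬝ᵥ v) hG ?_ ?_ ?_ hW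
  · change (0 : Fin m → k) ⬝ᵥ w = (0 : Fin m → k) ⬝ᵥ v
    rw [zero_dotProduct, zero_dotProduct]
  · intro W W' _ _ h h'
    change (W 0 + W' 0) ⬝ᵥ w = (W 1 + W' 1) ⬝ᵥ v
    rw [add_dotProduct, add_dotProduct, h, h']
  · intro c W _ h
    change (c • W 0) ⬝ᵥ w = (c • W 1) ⬝ᵥ v
    rw [smul_dotProduct, smul_dotProduct, h]

/-- Master lemma with a column pair: if `X ↦ X·B` lies in `deltaSpan (span G)` and `W₀·w = W₁·v` on the generators,
then `B₀·v = 0`, `B₀·w + B₁·v = 0`, `B₁·w = 0`. -/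
theorem dot_eq_zero_of_mem_deltaSpan {G : Set (Matrix (Fin 2) (Fin m) k)} {v w : Fin m → k}
    (hG : ∀ W ∈ G, W 0 ⬝ᵥ w = W 1 ⬝ᵥ v) {B : Matrix (Fin 2) (Fin m) k}
    (hB : (mulBilin k 2 2 m).flip B ∈ deltaSpan (Submodule.span k G)) :
    B 0 ⬝ᵥ v = 0 ∧ B 0 ⬝ᵥ w + B 1 ⬝ᵥ v = 0 ∧ B 1 ⬝ᵥ w = 0 := by
  have h := symm_of_mem_deltaSpan (symm_on_span hG) hB
  simp only [mul_pairCols_apply_zero, mul_pairCols_apply_one] at h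
  exact h

/-- A Kronecker sum over an indicator of a natural-number index: `Σ_i [i = r]·g i = g r` (`r < m`). -/
theorem sum_ite_coe_eq (r : ℕ) (hr : r < m) (g : Fin m → k) :
    ∑ i : Fin m, (if (i : ℕ) = r then (1 : k) else 0) * g i = g ⟨r, hr⟩ := by
  rw [Finset.sum_eq_single ⟨r, hr⟩]
  · simp
  · intro i _ hi
    have : (i : ℕ) ≠ r := fun h => hi (Fin.ext h)
    simp [this]
  · intro h; exact absurd (Finset.mem_univ _) h

/-- … and `= 0` when `r ≥ m`. -/
theorem sum_ite_coe_eq_zero (r : ℕ) (hr : m ≤ r) (g : Fin m → k) :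
    ∑ i : Fin m, (if (i : ℕ) = r then (1 : k) else 0) * g i = 0 := by
  refine Finset.sum_eq_zero fun i _ => ?_
  have : (i : ℕ) ≠ r := fun h => by have := i.2; omega
  simp [this]

end DeltaBlocks

end Summit.MatrixMultiplication.OmegaCensus.SmallFormats
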